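import Summits.CriticalPhenomena.SAWScalingLimit.Theorems.SAWDevelopingMapObservableToSLETypeLadderCarvedReductionSqueezeOuterStep
import Summits.CriticalPhenomena.SAWScalingLimit.Theorems.SAWDevelopingMapObservableToSLETypeLadderCarvedReductionSqueezeKernelFrontier
import HarnessLib

/-!
# The confined outer sequence `E_n` and the hypotheses of the frame (piece (T-A′₂F outer
# sequence) of stub T-A′₂F `stub_carvedReduction_squeezeGeometry_domainsCoreF`)

Crux `SAWDevelopingMap.ObservableToSLE` (stmt-CriticalPhenomena-10472), line `six-class-type-ladder`,
stub T-A′₂F `stub_carvedReduction_squeezeGeometry_domainsCoreF`.  Landing target: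
`Summits/CriticalPhenomena/SAWScalingLimit/Theorems/SAWDevelopingMapObservableToSLETypeLadderCarvedReductionSqueezeOuterSeq.lean`.

`outerSeq` iterates `outerStep` (previous stage `E_{n-1}` with good region `G'_{n-1}` and
deepness radius `r_{n-1}/4`; base stage `E` itself with good region `E` and empty hull) over an
increasing sequence of zone pairs `Z_n ⊆ Z'_n` with regions `X_n` (`X_{n+1}` off
`closure Z'_n`), and returns the outer approximants `E_n` of the super-domain `E` with exactly
the hypotheses of the frame `Squeeze.stub_carvedReduction_derivFrame` / `frameDatum`:
hull subdomains, MONOTONE pulled-back hulls inside the bulk hull `A = closure (ℍ ∖ φ.symm '' Ω)`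
(a `*`-hull, `bulkHull`), and the component-KERNEL property (`kernel_of_frontier`, from the
swallowing `Z_n ∩ E ∩ E_n = ∅` and the density hypothesis
`frontier Ω ∩ E ⊆ closure (⋃ n, Z_n ∩ E)`); moreover `G'_n ⊆ E_n` (the `b₀`-component of
`E ∖ closure (Z'_n ∩ E)`: every point joined to `b₀` off `closure Z'_n` survives — the reach
clause) and `Ω ⊆ E_n`.
Registered carrier: `stub_carvedReduction_outerSeq`.
-/

noncomputable section

open scoped Topology
open Filter Set Metric Bornology
open UpperHalfPlane (upperHalfPlaneSet isOpen_upperHalfPlaneSet)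
open Literature.Probability.RandomPlanarGeometry

namespace Summit.CriticalPhenomena.SAWScalingLimit.Theorems.ObservableToSLE.TypeLadder

/-- **THE CONFINED OUTER SEQUENCE**; see the module docstring. -/
theorem outerSeq (E : DobrushinDomain) (φ : ConformalEquiv upperHalfPlaneSet E.carrier)
    (hφ : E.IsChordalUniformizing φ) {Ω : Set ℂ} {b₀ : ℂ} (hΩo : IsOpen Ω) (hΩc : IsConnected Ω)
    (hΩE : Ω ⊆ E.carrier) (hb₀ : b₀ ∈ Ω) (hwin : ∀ i : Fin 2, ∃ W ∈ 𝓝 (E.pt i), W ∩ E.carrier ⊆ Ω)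
    (hΩcc : IsConnected Ωᶜ) (Z Z' X : ℕ → Set ℂ) (hZZ' : ∀ n, Z n ⊆ Z' n) (hZ'mono : Monotone Z')
    (hΩZ' : ∀ n, Disjoint Ω (closure (Z' n ∩ E.carrier)))
    (hatt : ∀ n, ∀ z ∈ Z n ∩ E.carrier,
      ∃ C : Set ℂ, IsOpen C ∧ IsPreconnected C ∧ z ∈ C ∧ C ⊆ Z n ∧ (C \ E.carrier).Nonempty)
    (hatt' : ∀ n, ∀ z ∈ Z' n ∩ E.carrier,
      ∃ C : Set ℂ, IsOpen C ∧ IsPreconnected C ∧ z ∈ C ∧ C ⊆ Z' n ∧ (C \ E.carrier).Nonempty)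
    (hmargin : ∀ n, ∃ d > (0 : ℝ), ∀ a ∈ Z n ∩ E.carrier, ∀ b ∈ E.carrier \ Z' n, d ≤ dist a b)
    (hXc : ∀ n, IsPreconnected (X n)) (hXb : ∀ n, b₀ ∈ X n) (hXE : ∀ n, X n ⊆ E.carrier)
    (hXZ : ∀ n, Disjoint (X n) (closure (Z n ∩ E.carrier)))
    (hXZ' : ∀ n, Disjoint (X (n + 1)) (closure (Z' n ∩ E.carrier)))
    (hLBS : ∀ n, ∀ p ∈ frontier E.carrier, ∃ N ∈ 𝓝 p, N ∩ E.carrier ⊆ Z' n ∨ N ∩ E.carrier ⊆ X n)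
    (hREM : frontier Ω ∩ E.carrier ⊆ closure (⋃ n, Z n ∩ E.carrier)) :
    ∃ En : ℕ → DobrushinDomain,
      (∀ n, E.IsHullSubdomain (En n)) ∧
      Monotone (fun n => φ.pullbackHull (En n)) ∧
      (∀ n, φ.pullbackHull (En n) ⊆ closure (upperHalfPlaneSet \ φ.symm '' Ω)) ∧
      (∀ W : Set ℂ, IsOpen W → IsPreconnected W →
        W ⊆ ⋂ n, upperHalfPlaneSet \ φ.pullbackHull (En n) →
        (W ∩ (upperHalfPlaneSet \ closure (upperHalfPlaneSet \ φ.symm '' Ω))).Nonempty →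
        W ⊆ upperHalfPlaneSet \ closure (upperHalfPlaneSet \ φ.symm '' Ω)) ∧
      (∀ n, connectedComponentIn (E.carrier \ closure (Z' n ∩ E.carrier)) b₀ ⊆ (En n).carrier) ∧
      (∀ n, Ω ⊆ (En n).carrier) ∧
      (∀ n, Disjoint (Z n ∩ E.carrier) (En n).carrier) ∧
      IsStarHull (closure (upperHalfPlaneSet \ φ.symm '' Ω)) ∧
      upperHalfPlaneSet \ closure (upperHalfPlaneSet \ φ.symm '' Ω) = φ.symm '' Ω := by
  classical
  obtain ⟨hAstar, hHA, -, -, -, -⟩ := bulkHull E φ Ω hφ hΩo hΩc hΩE hwin hΩcc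
  set G' : ℕ → Set ℂ := fun n => connectedComponentIn (E.carrier \ closure (Z' n ∩ E.carrier)) b₀ with hG'def
  -- the invariant of stage `n`
  set Inv : ℕ → DobrushinDomain × ℝ → Prop := fun n p =>
    E.IsHullSubdomain p.1 ∧ 0 < p.2 ∧ (∀ w ∈ φ.pullbackHull p.1, p.2 / 4 ≤ infDist w (closure (φ.symm '' G' n))) ∧
      G' n ⊆ p.1.carrier ∧ φ.pullbackHull p.1 ⊆ closure (upperHalfPlaneSet \ φ.symm '' G' n) ∧
      Disjoint (Z n ∩ E.carrier) p.1.carrier with hInvdef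
  -- the good components
  have hΩG' : ∀ n, Ω ⊆ G' n := fun n =>
    window_subset_bulk hΩc.isPreconnected (fun z hz => ⟨hΩE hz, disjoint_left.1 (hΩZ' n) hz⟩) hb₀
  have hG'anti : ∀ n, G' (n + 1) ⊆ G' n := by
    intro n
    have h1 : G' (n + 1) ⊆ E.carrier \ closure (Z' n ∩ E.carrier) := fun z hz =>
      ⟨(connectedComponentIn_subset _ _ hz).1, fun h' => (connectedComponentIn_subset _ _ hz).2
        (closure_mono (inter_subset_inter_left _ (hZ'mono (Nat.le_succ n))) h')⟩
    exact subset_bulk_of_mem isPreconnected_connectedComponentIn h1 (hΩG' (n + 1) hb₀) (hΩG' n hb₀)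
  have hXG' : ∀ n, X (n + 1) ⊆ G' n := fun n =>
    subset_bulk_of_mem (hXc (n + 1)) (fun z hz => ⟨hXE (n + 1) hz, disjoint_left.1 (hXZ' n) hz⟩) (hXb (n + 1))
      (hΩG' n hb₀)
  -- the step at index `n`
  have hstep : ∀ (n : ℕ) (Ep : DobrushinDomain) (Gp : Set ℂ) (rp : ℝ), E.IsHullSubdomain Ep → Gp ⊆ Ep.carrier →
      X n ⊆ Gp → G' n ⊆ Gp → 0 < rp → (∀ w ∈ φ.pullbackHull Ep, rp ≤ infDist w (closure (φ.symm '' Gp))) →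
      ∃ p : DobrushinDomain × ℝ, Inv n p ∧ φ.pullbackHull Ep ⊆ φ.pullbackHull p.1 := by
    intro n Ep Gp rp hEp hGpEp hXGp hG'Gp hrp hdeep
    obtain ⟨d₁, hd₁, hmar⟩ := hmargin n
    obtain ⟨En, r, hEn, hr, hdeepn, hG'n, hPA, hdisj, hmono⟩ := outerStep E φ hφ hΩc hΩE hb₀ hwin (hZZ' n) (hΩZ' n)
      (hatt n) (hatt' n) hd₁ hmar (hXc n) (hXb n) (hXZ n) (hLBS n) Ep hEp hGpEp hXGp hG'Gp hrp hdeep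
    exact ⟨(En, r), ⟨hEn, hr, hdeepn, hG'n, hPA, hdisj⟩, hmono⟩
  -- the base stage: `E` itself, good region `E`, empty hull
  obtain ⟨p₀, hp₀, -⟩ := hstep 0 E E.carrier 1 (MarkedDomain.isHullSubdomain_self _) Subset.rfl (hXE 0)
    (fun z hz => (connectedComponentIn_subset _ _ hz).1) one_pos (by
      intro w hw
      have hdom : φ.pullbackDomain E = upperHalfPlaneSet :=
        Set.ext fun z => ⟨fun h => h.1, fun h => ⟨h, φ.mapsTo h⟩⟩
      rw [ConformalEquiv.pullbackHull, hdom, sdiff_self] at hw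
      simp at hw)
  -- the successor stages
  have hsucc : ∀ (n : ℕ) (p : {p : DobrushinDomain × ℝ // Inv n p}),
      ∃ q : {q : DobrushinDomain × ℝ // Inv (n + 1) q}, φ.pullbackHull p.1.1 ⊆ φ.pullbackHull q.1.1 := by
    intro n p
    obtain ⟨hEp, hrp, hdeep, hG'p, -, -⟩ := p.2
    obtain ⟨q, hq, hmono⟩ := hstep (n + 1) p.1.1 (G' n) (p.1.2 / 4) hEp hG'p (hXG' n) (hG'anti n)
      (by positivity) hdeep
    exact ⟨⟨q, hq⟩, hmono⟩
  choose next hnext using hsucc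
  let seq : (n : ℕ) → {p : DobrushinDomain × ℝ // Inv n p} := fun n =>
    Nat.rec (motive := fun n => {p : DobrushinDomain × ℝ // Inv n p}) ⟨p₀, hp₀⟩ (fun m p => next m p) n
  have hseq_succ : ∀ n, seq (n + 1) = next n (seq n) := fun n => rfl
  have hInv : ∀ n, Inv n (seq n).1 := fun n => (seq n).2
  refine ⟨fun n => (seq n).1.1, fun n => (hInv n).1, ?_, ?_, ?_, fun n => (hInv n).2.2.2.1,
    fun n => (hΩG' n).trans (hInv n).2.2.2.1, fun n => (hInv n).2.2.2.2.2, hAstar, hHA⟩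
  · refine monotone_nat_of_le_succ fun n => ?_
    show φ.pullbackHull (seq n).1.1 ⊆ φ.pullbackHull (seq (n + 1)).1.1
    rw [hseq_succ]
    exact hnext n (seq n)
  · intro n
    refine (hInv n).2.2.2.2.1.trans (closure_mono (Set.sdiff_subset_sdiff_right (image_mono (hΩG' n))))
  · refine kernel_of_frontier E φ Ω (closure (upperHalfPlaneSet \ φ.symm '' Ω)) (fun n => (seq n).1.1) hΩo hΩE hHA ?_
    refine hREM.trans (closure_mono (iUnion_subset fun n z hz => ?_))
    exact ⟨n, fun h => disjoint_left.1 (hInv n).2.2.2.2.2 hz h⟩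

/-- **Registered carrier `stub_carvedReduction_outerSeq`** (crux item stmt-CriticalPhenomena-10472,
stub T-A′₂F `stub_carvedReduction_squeezeGeometry_domainsCoreF`, piece THE OUTER SEQUENCE): a
connected union lemma — `F ∪ closure (Z ∩ E)` is connected for a connected `F ⊇ Eᶜ` when every
point of `Z ∩ E` lies in an open preconnected piece of `Z` leaving the open set `E`. -/
theorem stub_carvedReduction_outerSeq :
    ∀ (F Z E : Set ℂ), IsConnected F → Eᶜ ⊆ F → IsOpen E →
      (∀ z ∈ Z ∩ E, ∃ C : Set ℂ, IsOpen C ∧ IsPreconnected C ∧ z ∈ C ∧ C ⊆ Z ∧ (C \ E).Nonempty) →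
      IsConnected (F ∪ closure (Z ∩ E)) :=
  fun _ _ _ hF hEF hE hatt => isConnected_union_closure_inter hF hEF hE hatt

end Summit.CriticalPhenomena.SAWScalingLimit.Theorems.ObservableToSLE.TypeLadder

end
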